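import Summits.Ventures.HSemireg.SecantParityObjectLevelEffectiveCycles
import Summits.Ventures.HSemireg.SecantParityObjectLevelSignedLaw
import Literature.Geometry.Kaehler.ComplexTorusAnalyticHypersurfaceSelfIntersection
import Literature.Geometry.Kaehler.ComplexTorusDivisorClassesLowCodimension
import Literature.Geometry.Kaehler.ComplexTorusRefinedHumbertInvariant
import HarnessLib

/-!
# Venture HSemireg — INSTANCES and CONTRAPOSITIVES for file VIII `SecantParityObjectLevelEffectiveCycles` (TRACK S4-PUSH (ii), seat
# `s4-prove-1` g10; file VIIIb; for filing once VIII's hub olean is built; file of record `s4push/prove-1/ATTEMPT-11.md` §4 VACUITY)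

HONEST FRAMING as in file VIII. Theorems only (0 def, 0 named fact, 0 sorry). (a) NON-VACUITY at `p = 1`: every analytic hypersurface `D ⊂ X`
with `(D^g) ≠ 0` inhabits the hypothesis `hcl` of VIII's main theorem with `c = 1`, `Ξ = -η_D` (tree: such a `D` is `c₁` of a positive line bundle),
and the main theorem returns its negative branch; (b) CONTRAPOSITIVE: a non-degenerate `(1,1)`-class of INTERMEDIATE index `0 < s < g` is never
`c⁻¹ • [Z]` for a closed analytic `Z` of pure codimension `p`, `1 ≤ p ≤ g - 1`, `c > 0` (e.g. the sheet's `E⁴` class; file V-b's `η_s`);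
(c) **(S3) FOR CYCLE-TYPE OBJECTS WITH NO (H1) AND NO POLARISATION HYPOTHESIS**: `[Z] = c • Ξ^{∧2}` (`c > 0`, `Ξ ∈ NS` non-degenerate)
and th-7 §D's χ-identity BY VALUE for `Ξ` at `n = 2m` (file IV's `hHRR`) ⇒ `m` odd, `4 ∤ n` — file VIII's dichotomy feeds file IV's two Riemann-form branches.
Nothing here says HC / HC_CM / HC_AV holds; (S3)'s words do not move.
-/

noncomputable section

open scoped Manifold ComplexOrder
open Complex Module Function
open Literature.Geometry.Kaehler Literature.Geometry.Kaehler.ComplexTorus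

namespace Summit.Ventures.HSemireg

namespace SecantParity

universe u

variable {ι : Type*} [Fintype ι] [DecidableEq ι] {E : Type u} [NormedAddCommGroup E] [InnerProductSpace ℂ E]
  [FiniteDimensional ℂ E] [MeasurableSpace E] [BorelSpace E] (Φ : (ι → ℝ) ≃L[ℝ] E) {n d : ℕ} (e : Fin n ≃ ι)

/-- **Non-vacuity of VIII at `p = 1`**: an analytic hypersurface `D` (pure dimension `q`, `rk Λ = 2q + 2`) with `(D^g) ≠ 0` and a positively
oriented `e` give `[D]_e = 1 • Ξ^{∧1}` for the `NS` form `Ξ = -η_D`, `η_D` the Riemann form of `D` (tree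
`exists_isRiemannForm_analyticCycleClass_eq_of_torusIntegral_wedgePow_ne_zero`), with `H_Ξ` non-degenerate and negative definite.
[cite: Lange2023AbelianVarietiesComplex, §2.1.3 Prop. 2.1.11] [cite: Chirka1989, §14.2 Prop. 2] -/
theorem exists_analyticCycleClass_eq_smul_wedgePow_one_of_hypersurface {q g : ℕ} (hq : 2 * q + 2 * 1 = 2 * g) (e : Fin (2 * g) ≃ ι)
    {D : Set (ComplexTorus Φ)} (hD : HasPureDim 𝓘(ℂ, E) D q) (he : orientationSign Φ e = 1)
    (hDg : torusIntegral Φ e (wedgePow (analyticCycleClass Φ e hq hD) g) ≠ 0) :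
    ∃ Ξ : E [⋀^Fin 2]→L[ℝ] ℝ, IsNSForm Φ Ξ ∧ (∀ v : E, v ≠ 0 → ∃ w : E, Ξ ![v, w] ≠ 0) ∧
      analyticCycleClass Φ e hq hD = ((1 : ℝ) : ℂ) • wedgePow (ofRealForm Ξ) 1 ∧ IsRiemannForm Φ (-Ξ) := by
  obtain ⟨η, hη, hcl⟩ := exists_isRiemannForm_analyticCycleClass_eq_of_torusIntegral_wedgePow_ne_zero Φ e hq hD he hDg
  refine ⟨-η, hη.isNSForm.neg, fun v hv ↦ ?_, ?_, by rwa [neg_neg]⟩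
  · obtain ⟨w, hw⟩ := hη.exists_apply_ne_zero Φ v hv
    exact ⟨w, by rwa [ContinuousAlternatingMap.neg_apply, neg_ne_zero]⟩
  · rw [hcl, Complex.ofReal_one, one_smul, wedgePow_one_eq_self]

/-- … and VIII's main theorem, fed with this instance, returns the NEGATIVE branch (`Even 1` is false): the hypothesis set of
`neg_or_even_and_pos_of_analyticCycleClass_eq_smul_wedgePow` is inhabited and its conclusion is the true one.
[cite: Chirka1989, §14.2 Prop. 2 and App. A4.5] -/
theorem neg_of_hypersurface_via_main {q g : ℕ} (hq : 2 * q + 2 * 1 = 2 * g) (e : Fin (2 * g) ≃ ι)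
    {D : Set (ComplexTorus Φ)} (hD : HasPureDim 𝓘(ℂ, E) D q) (he : orientationSign Φ e = 1) (hq1 : 1 ≤ q)
    (hDg : torusIntegral Φ e (wedgePow (analyticCycleClass Φ e hq hD) g) ≠ 0) :
    ∃ Ξ : E [⋀^Fin 2]→L[ℝ] ℝ, analyticCycleClass Φ e hq hD = ((1 : ℝ) : ℂ) • wedgePow (ofRealForm Ξ) 1 ∧
      ∀ v : E, v ≠ 0 → Ξ ![I • v, v] < 0 := by
  obtain ⟨Ξ, hΞ, hnd, hcl, -⟩ := exists_analyticCycleClass_eq_smul_wedgePow_one_of_hypersurface Φ hq e hD he hDg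
  refine ⟨Ξ, hcl, ?_⟩
  rcases neg_or_even_and_pos_of_analyticCycleClass_eq_smul_wedgePow Φ e hq hD he le_rfl hq1 hΞ.type_one_one hnd one_pos hcl
    with hneg | ⟨hev, -⟩
  · exact hneg
  · exact absurd hev (by decide)

/-- **CONTRAPOSITIVE: intermediate index is never a cycle class power.** If `Ξ ∈ NS(X)` is non-degenerate with `0 < hermIndex Ξ < g`
(`g = p + d = dim X`; e.g. the `E⁴` class `e₁+e₂+e₃-e₄` of index `1`, or file V-b's `η_s`, `0 < s < g`), then for NO closed analytic `Z` of pure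
dimension `d ≥ 1`, NO `c > 0` and NO positively oriented `e` is `[Z]_e = c • Ξ^{∧p}` (`p ≥ 1`): such classes are not secant directions of
cycle-type secant sheaves. [cite: Chirka1989, §14.2 Prop. 2] [cite: Lange2023AbelianVarietiesComplex, §1.6.2 (p0066)] -/
theorem analyticCycleClass_ne_smul_wedgePow_of_hermIndex_intermediate {p : ℕ} (h : 2 * d + 2 * p = n)
    {Z : Set (ComplexTorus Φ)} (hZ : HasPureDim 𝓘(ℂ, E) Z d) (he : orientationSign Φ e = 1) (hp : 1 ≤ p) (hd : 1 ≤ d)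
    {Ξ : E [⋀^Fin 2]→L[ℝ] ℝ} (hΞ : IsNSForm Φ Ξ) (hnd : ∀ v : E, v ≠ 0 → ∃ w : E, Ξ ![v, w] ≠ 0)
    (h0 : 0 < hermIndex Ξ) (hg : hermIndex Ξ < p + d) {c : ℝ} (hc : 0 < c) :
    analyticCycleClass Φ e h hZ ≠ (c : ℂ) • wedgePow (ofRealForm Ξ) p := by
  intro hcl
  rcases hermIndex_eq_of_analyticCycleClass_eq_smul_wedgePow Φ e h hZ he hp hd hΞ hnd hc hcl with hG | ⟨-, hzero⟩
  · exact absurd hG (by omega)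
  · exact absurd hzero (by omega)

/-- **(S3) FOR CYCLE-TYPE SECANT OBJECTS — no (H1), no polarisation datum among the hypotheses.** `X` a complex torus with a positively
oriented enumeration `e` (`rk Λ = 2d + 4`), `Z ⊂ X` closed analytic of pure dimension `d ≥ 1` with `[Z]_e = c • Ξ^{∧2}`, `c > 0`, `Ξ ∈ NS(X)`
non-degenerate (the secant direction of a cycle-type secant sheaf, ATTEMPT-11 §1), and th-7 §D's χ-identity BY VALUE for `Ξ` at `n = 2m`
(`(2w(-4d_K)^m/(2m)!)·∫_X Ξ^{∧2m} = G·(-2)`, `d_K, w, G > 0`, file IV's `hHRR`) ⇒ **`m` is odd and `4 ∤ 2m`** — (S3)'s conclusion, with (H1) DISCHARGED by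
effectivity (file VIII: `-Ξ` or `Ξ` is a Riemann form) into file IV's two polarised branches. [cite: Chirka1989, §14.2 Prop. 2] [cite: Lange2023AbelianVarietiesComplex, §1.7.2 Lemma 1.7.5 and proof of Thm. 1.7.3] -/
theorem odd_and_not_four_dvd_of_analyticCycleClass_eq_smul_wedgePow_two_of_chi_identity (h : 2 * d + 2 * 2 = n)
    {Z : Set (ComplexTorus Φ)} (hZ : HasPureDim 𝓘(ℂ, E) Z d) (he : orientationSign Φ e = 1) (hd : 1 ≤ d)
    {Ξ : E [⋀^Fin 2]→L[ℝ] ℝ} (hΞ : IsNSForm Φ Ξ) (hnd : ∀ v : E, v ≠ 0 → ∃ w : E, Ξ ![v, w] ≠ 0) {c : ℝ} (hc : 0 < c)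
    (hcl : analyticCycleClass Φ e h hZ = (c : ℂ) • wedgePow (ofRealForm Ξ) 2)
    {m : ℕ} (e' : Fin (2 * (2 * m)) ≃ ι) {dK w G : ℝ} (hdK : 0 < dK) (hw : 0 < w) (hG : 0 < G)
    (hHRR : (2 * (w : ℂ) * (-4 * (dK : ℂ)) ^ m / ((2 * m).factorial : ℂ)) *
        torusIntegral Φ e' (wedgePow (ofRealForm Ξ) (2 * m)) = (G : ℂ) * (-2)) :
    Odd m ∧ ¬ 4 ∣ 2 * m := by
  rcases isRiemannForm_neg_or_of_analyticCycleClass_eq_smul_wedgePow_two Φ e h hZ he hd hΞ hnd hc hcl with hneg | hpos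
  · exact IsRiemannForm.odd_and_not_four_dvd_of_chi_identity_neg Φ hneg e' hdK hw hG (by rwa [neg_neg])
  · exact IsRiemannForm.odd_and_not_four_dvd_of_chi_identity Φ hpos e' hdK hw hG hHRR

end SecantParity

end Summit.Ventures.HSemireg
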